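import Summits.BirchSwinnertonDyer.BirchSwinnertonDyer.Theorems.UniversalToricDescentRationalSplitIMCInclusionAtThreeClosedModuloV84
import HarnessLib

/-!
# THE FRAME INVOLUTION TRANSPORTS ♯♯-FRAMES: `φ_{A_τ}` of a `(C, X, Y)`-frame is a `(C, Y/κ̂, X·κ̂)`-frame, `κ̂ = ι′⁻¹(N·|d_K|/4)`
# (helper on the rational wall `RationalSplitIMCInclusionAtThree`, stmt-BirchSwinnertonDyer-24207, line `ratwall_thin_comb` v10;
# cell `pub/bsd-wall`, LEAD `cruxlead-24207` g36; `--supports stmt-BirchSwinnertonDyer-24207`; nothing is closed; BSD is not proved)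

WHY THIS FILE. The certificates V83/V84/V85 derive the registered symmetry clause «`φ_{A_τ} L₂ ∼ L₂`» of the line's first stub from a NORMALISED
frame by running the transfer (`…ThinComb.ReflectionTransfer`), the reflected partner (`…ThinComb.ReflectedAvatar`) and the display functional
equation (`…ThinComb.DisplayFunctionalEquation`, Jacquet's cone fact BY NAME) on the fibred supply. The same three ingredients give a cleaner,
supply-free and normalisation-free statement, recorded here once: **for EVERY ♯♯-frame `L₂` with constants `(C, X, Y)` the transformed series
`φ_{A_τ} L₂` is a ♯♯-frame with constants `(C, Y·κ̂⁻¹, X·κ̂)`**, `κ̂ = ι′⁻¹(N·|d_K|/4)` the display constant of Jacquet's functional equation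
(root number `+1`, conductor `(N·|d_K|)²`), POINTWISE on the whole interpolation scope. Consequences for the line (LEAD-CENSUS-g36 §2): the ratio
`λ₀ = X·κ̂/Y` governs the symmetry — `φ_{A_τ}` maps `(X, Y) ↦ (X/λ₀, Y·λ₀)` — so with the grading renormalisation of `…ThinComb.GradingRenormalisation`
(both gradings free up to `ℤ₃ˣ`) the symmetry clause of v8.2 holds for every frame whose `λ₀` lies in `ℤ₃ˣ` as soon as frames with equal constants
coincide (two-variable rigidity on the fibred supply); and a frame can only be FIXED by `φ_{A_τ}` up to a unit if `λ₀²` is «interpolable». This is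
the Galois/analytic side of Hao–Loeffler's §4 functional-equation argument, for the tree's predicate, with no running assumption.

* `isToricTwoVarLFunctionUpTo₂_frameSubst_involution` — the statement above (p = 3, the line's prime; `K` imaginary quadratic Heegner for `N`,
  `3 = 𝔭𝔭′`, `f` a `Γ₀(N)`-newform, any generator pair, any complex conjugation `c`, any lift `τ` of `g ↦ c g⁻¹ c⁻¹` with frame matrix `A`;
  Jacquet's cone fact as a hypothesis BY NAME).

HONEST SCOPE: a statement about the interpolation predicate under a named print fact; nothing here is evidence that a frame exists at an additive
split `3`; BSD is proved for no curve; 24207 / 20395 / 20186 / 32493 OPEN.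

References: [cite: Jacquet1972, §19 Thm. 19.14, Cor. 19.15] [cite: Tate1979, (3.1), (3.2.3), (3.4)] [cite: BuyukbodukLei2017, Def. 3.8 (arXiv:1707.00557)]
[cite: HaoLoeffler2025, §4 (the FE argument; arXiv:2405.12611)] [cite: CastellaWan2023, §2.4 Thm. 2.11 (arXiv:1607.02019)] [cite: Weil1956, §1–§2]
-/

set_option linter.dupNamespace false
set_option autoImplicit false

noncomputable section

open scoped Classical MatrixGroups

namespace Summit.BirchSwinnertonDyer.BirchSwinnertonDyer.Theorems.UniversalToricDescentThinComb.FrameReflection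

open NumberField IsDedekindDomain Field
open Literature.NumberTheory.EllipticCurves Literature.NumberTheory.GaloisRepresentations
open Literature.NumberTheory.EllipticCurves.ModularForms
open Summit.BirchSwinnertonDyer.BirchSwinnertonDyer.Theorems.UniversalToricDescentThinComb

/-- **THE FRAME INVOLUTION TRANSPORTS ♯♯-FRAMES.** `K` imaginary quadratic Heegner for `N`, `3 = 𝔭𝔭′` (`3 ∈ 𝔭`, `3 ∈ 𝔭′`, `𝔭′ ≠ 𝔭`), `f` a
newform on `Γ₀(N)`, `(κ₁, κ₂; γ₁, γ₂)` a generator pair, `c ∈ Γ_ℚ ∖ res(Γ_K)`, `τ` a lift of `g ↦ c g⁻¹ c⁻¹`, `A = frameMatrixOf κ₁ κ₂ γ₁ γ₂ τ`. Under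
Jacquet's cone fact: if `L₂` is a ♯♯-frame with constants `(C, X, Y)` then `φ_A L₂` is a ♯♯-frame with constants `(C, Y·κ̂⁻¹, X·κ̂)`,
`κ̂ = ι′⁻¹(N·|d_K|/4)`. PROOF (pointwise): at a scope point `(ψ, a, b, r, L)`, `(φ_A L₂)(r γ₁ − 1, r γ₂ − 1) = L₂(r(τγ₁) − 1, r(τγ₂) − 1)` (frame
covariance); `r∘τ` is an avatar through the pair of the reflected partner `ψ† = (ψ∘c̄)⁻¹` of type `(b, −a)` (`exists_reflected_partner`), so the frame
gives the value `C X^b Y^a ι′⁻¹V(ψ†; b, a)` there (continuation of `ψ†` from the cone fact); and `κ^a V(ψ†; b, a) = κ^b V(ψ; a, b)`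
(`displayFE_of_lambdaFE_at_one` from the `Λ`-functional equation at `s = 1`), whence the value is `C (Yκ̂⁻¹)^a (Xκ̂)^b ι′⁻¹V(ψ; a, b)`.
[cite: Jacquet1972, §19 Thm. 19.14, Cor. 19.15] [cite: BuyukbodukLei2017, Def. 3.8 (arXiv:1707.00557)] [cite: HaoLoeffler2025, §4 (arXiv:2405.12611)] -/
theorem isToricTwoVarLFunctionUpTo₂_frameSubst_involution
    (hJ : Literature.NumberTheory.EllipticCurves.jacquet1972_functionalEquation_rankinSelbergHecke_cone)
    {K : Type} [Field K] [NumberField K] (hK : IsImaginaryQuadratic K) {N : ℕ} [NeZero N]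
    (f : CuspForm (CongruenceSubgroup.Gamma0 N) 2) (hf : IsNewform0 f) (hH : SatisfiesHeegnerHypothesis N K)
    {𝔭 𝔭' : HeightOneSpectrum (𝓞 K)} (h3 : ((3 : ℕ) : 𝓞 K) ∈ 𝔭.asIdeal) (h3' : ((3 : ℕ) : 𝓞 K) ∈ 𝔭'.asIdeal) (hne : 𝔭' ≠ 𝔭)
    (ι' : PadicAlgCl 3 ≃+* ℂ) {κ₁ κ₂ : ZpExtension K 3} {γ₁ γ₂ : Field.absoluteGaloisGroup K}
    (hpair : ZpExtension.IsTopGeneratorPair κ₁ κ₂ γ₁ γ₂)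
    {c : Field.absoluteGaloisGroup ℚ} (hc : c ∉ Set.range (absGaloisRestrict ℚ K))
    {τ : Field.absoluteGaloisGroup K → Field.absoluteGaloisGroup K}
    (hτ : ∀ σ, absGaloisRestrict ℚ K (τ σ) = c * (absGaloisRestrict ℚ K σ)⁻¹ * c⁻¹)
    (A : GL (Fin 2) ℤ_[3]) (hA : (A : Matrix (Fin 2) (Fin 2) ℤ_[3]) = IwasawaAlgebra₂.frameMatrixOf κ₁ κ₂ γ₁ γ₂ τ)
    {ΩK : ℂ} {C X Y : ℂ_[3]} {L₂ : PowerSeries (PowerSeries (unrIntegers 3))}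
    (hL : IsToricTwoVarLFunctionUpTo₂ C X Y ι' 𝔭 𝔭' κ₁ κ₂ γ₁ γ₂ f ΩK L₂) :
    letI : Algebra ℤ_[3] (unrIntegers 3) := (Summit.BirchSwinnertonDyer.Rank1Residual.X11b.Halves.toUnr 3).toAlgebra
    IsToricTwoVarLFunctionUpTo₂ C
      (Y * ((((ι'.symm ((N : ℂ) * ((NumberField.discr K).natAbs : ℂ) / 4) : PadicAlgCl 3)) : ℂ_[3]))⁻¹)
      (X * (((ι'.symm ((N : ℂ) * ((NumberField.discr K).natAbs : ℂ) / 4) : PadicAlgCl 3)) : ℂ_[3]))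
      ι' 𝔭 𝔭' κ₁ κ₂ γ₁ γ₂ f ΩK (IwasawaAlgebra₂.frameSubst (unrIntegers 3) A L₂) := by
  letI : Algebra ℤ_[3] (unrIntegers 3) := (Summit.BirchSwinnertonDyer.Rank1Residual.X11b.Halves.toUnr 3).toAlgebra
  haveI : IsGalois ℚ K := Literature.FieldTheory.Galois.isGalois_of_finrank_eq_two hK.1
  set κc : ℂ := (N : ℂ) * ((NumberField.discr K).natAbs : ℂ) / 4 with hκc
  have hκc0 : κc ≠ 0 := by
    refine div_ne_zero (mul_ne_zero (by exact_mod_cast NeZero.ne N) ?_) (by norm_num)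
    exact_mod_cast Int.natAbs_ne_zero.mpr (NumberField.discr_ne_zero K)
  set κh : ℂ_[3] := (((ι'.symm κc : PadicAlgCl 3)) : ℂ_[3]) with hκh
  have hκh0 : κh ≠ 0 := by
    rw [hκh, PadicComplex.coe_eq]
    exact (map_ne_zero_iff _ (algebraMap (PadicAlgCl 3) ℂ_[3]).injective).mpr ((map_ne_zero_iff _ ι'.symm.injective).mpr hκc0)
  -- the swap of the two places above `3` by `g = c̄`
  set g := absGaloisQuot ℚ K c with hgdef
  have hg𝔭 : g • 𝔭 = 𝔭' := UniversalToricDescentRatwallThinCombLine.V83Jacquet.absGaloisQuot_smul_eq hK hc h3 h3' hne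
  have hg𝔭' : g • 𝔭' = 𝔭 := UniversalToricDescentRatwallThinCombLine.V83Jacquet.absGaloisQuot_smul_eq hK hc h3' h3 (Ne.symm hne)
  intro ψ a b ha hb hinf hunr r hr hrκ L hLd hLe
  -- the reflected partner `(ψ†, r†)`, `r† = r ∘ τ`
  obtain ⟨ψ', r', hψ', hinf', hunr', hr', hrκ', hval⟩ :=
    ReflectedAvatar.exists_reflected_partner hK ι' hpair hc hτ hinf hunr hr hrκ
  -- Jacquet at `ψ` (continuations of `ψ`, `ψ⁻¹` and the `Λ`-functional equation) and at `ψ†` (its continuation)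
  obtain ⟨L₁, L₁', hL₁, hL₁', hL₁e, hL₁'e, hFE⟩ := hJ K hK f hf hH ψ a b ha hb hunr hinf
  obtain ⟨L'', -, hL'', -, hL''e, -, -⟩ := hJ K hK f hf hH ψ' b a hb ha hunr' hinf'
  -- the value of `L₂` at the partner point, transported to `φ_A L₂` at the point of `r`
  have hv := hL ψ' b a hb ha hinf' hunr' r' hr' hrκ' L'' hL'' hL''e
  rw [hval γ₁, hval γ₂] at hv
  have h := (FrameCovariance.hasValueAt₂_frameSubst_frameMatrixOf_iff hpair hrκ τ A hA L₂ _).mpr hv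
  -- the `Λ`-identity at `s = 1`
  have hb' : (1 : ℝ) ≤ b := by exact_mod_cast hb
  have ha' : (1 : ℝ) ≤ a := by exact_mod_cast ha
  have h1 := hFE 1 (by rw [Complex.one_re]; linarith) (by rw [Complex.one_re]; linarith)
  have e1 : (1 : ℂ) + b - 1 = b := by ring
  have e2 : (a : ℂ) + 1 - 1 = a := by ring
  have e3 : (a : ℂ) + 2 - 1 = a + 1 := by ring
  have e4 : (2 : ℂ) + a - b - 2 * 1 = a - b := by ring
  have e5 : (2 : ℂ) - 1 = 1 := by ring
  rw [e1, e2, e3, e4, e5, add_comm (1 : ℂ) (b : ℂ)] at h1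
  have hLL : L₁ = L := DisplayFunctionalEquation.eq_of_entire_of_eqOn_halfPlane hLd hLe hL₁ hL₁e
  rw [hLL] at h1
  -- the display functional equation with `κ = N·|d_K|/4`
  have hL''e' : ∀ s : ℂ, (b : ℝ) + 2 < s.re → L'' s = rankinSelbergEulerProductHecke f (HeckeCharacter.galConj g ψ)⁻¹ s := by
    intro s hs; rw [← hψ']; exact hL''e s hs
  have hdisp := DisplayFunctionalEquation.displayFE_of_lambdaFE_at_one (p := 3) f g hg𝔭 hg𝔭' hunr ΩK hL₁' hL₁'e hL'' hL''e' h1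
  rw [← hψ'] at hdisp
  -- read the display identity in `ℂ_3` through `ι′⁻¹`
  have hdisp' : κh ^ a * (((ι'.symm (toricInterpolationValue 3 f 𝔭 𝔭' ψ' b a ΩK (L'' 1))) : PadicAlgCl 3) : ℂ_[3]) =
      κh ^ b * (((ι'.symm (toricInterpolationValue 3 f 𝔭 𝔭' ψ a b ΩK (L 1))) : PadicAlgCl 3) : ℂ_[3]) := by
    have := congrArg (fun z : ℂ ↦ (((ι'.symm z : PadicAlgCl 3)) : ℂ_[3])) hdisp
    simpa only [map_mul, map_pow, PadicComplex.coe_eq, hκh] using this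
  have hV : (((ι'.symm (toricInterpolationValue 3 f 𝔭 𝔭' ψ' b a ΩK (L'' 1))) : PadicAlgCl 3) : ℂ_[3]) =
      κh ^ b * (((ι'.symm (toricInterpolationValue 3 f 𝔭 𝔭' ψ a b ΩK (L 1))) : PadicAlgCl 3) : ℂ_[3]) * (κh ^ a)⁻¹ := by
    rw [eq_mul_inv_iff_mul_eq₀ (pow_ne_zero _ hκh0), mul_comm _ (κh ^ a)]
    exact hdisp'
  convert h using 1
  rw [hV, mul_pow, mul_pow, inv_pow]
  field_simp

end Summit.BirchSwinnertonDyer.BirchSwinnertonDyer.Theorems.UniversalToricDescentThinComb.FrameReflection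

end
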